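import Literature.NumberTheory.Transcendental.ZudilinOddZeta
import Literature.NumberTheory.Transcendental.ReciprocalBricks
import HarnessLib

/-!
# Zudilin's rational function `Rₙ(k)` as a product of bricks; antisymmetry; regularisation

Topic `Literature/NumberTheory/Transcendental`. For the data of [Zudilin2004, Theorem 3]
(`Literature.NumberTheory.Transcendental.Zudilin2004.R`, file `ZudilinOddZeta.lean`; Fischler's
variable `k = t + 27n + 1`), this file proves:

* `Zudilin2004.R_eq_bricks` — the factorisation (8.7)×(8.2) into Nesterenko bricks:
  `Rₙ(k) = (37n+2k) · P₁(k)³ · P₂(k)³ · ∏_{u=1}^{10} Q_u(k)` with the polynomial bricks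
  `P₁ = polyBrick (-27n) (27n)` (`= (k-27n)₂₇ₙ/(27n)!`), `P₂ = polyBrick (37n+1) (27n)`
  (`= (k+37n+1)₂₇ₙ/(27n)!`) and the reciprocal bricks
  `Q_u = recipBrick ((12-u)n) ((13+2u)n+1)` (`= ((13+2u)n)!/(k+(12-u)n)_{(13+2u)n+1}`);
* `Zudilin2004.R_neg` — the well-poised antisymmetry `Rₙ(-37n-k) = -Rₙ(k)` ([Zudilin2004, (8.5)]:
  `R̃(-t-h₀) = -R̃(t)`), valid for every `k` (both sides are `0` at the poles);
* `Zudilin2004.G n i` — the product `Rₙ(k)(k+i)^{10}` with its removable singularity at `k = -i`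
  removed (each reciprocal brick absorbs one factor `k + i`, `recipBrickReg`), and
  `Zudilin2004.G_eq` — `G n i k = Rₙ(k) (k+i)^{10}` away from the poles.

Everything here is PROVED (no named facts).

## References

* [Zudilin2004] W. Zudilin, *Arithmetic of linear forms involving odd zeta values*, J. Théor.
  Nombres Bordeaux 16 (2004), 251–291, §8: (8.2), (8.5), (8.7), proof of Lemma 19.
* [Fischler2004] S. Fischler, Sém. Bourbaki exp. 910, Astérisque 294 (2004), §3.3.
-/

noncomputable section

open Finset Filter Literature.Analysis.Calculus

namespace Literature.NumberTheory.Transcendental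

namespace Zudilin2004

/-! ### Reindexing the products -/

/-- `∏_{i=1}^{m} (k - i) = ∏_{l<m} (k + (-m) + l)`. [folklore] -/
theorem prod_Icc_sub_eq (m : ℕ) (k : ℚ) :
    ∏ i ∈ Icc 1 m, (k - i) = ∏ l ∈ range m, (k + ((-(m : ℤ) : ℤ) : ℚ) + l) := by
  rw [← prod_range_reflect, show Icc 1 m = Ico 1 (m + 1) by rfl, prod_Ico_eq_prod_range,
    Nat.add_sub_cancel]
  refine prod_congr rfl fun l hl => ?_
  have hl' := mem_range.1 hl
  rw [Nat.cast_sub (by omega), Nat.cast_sub (by omega)]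
  push_cast
  ring

/-- `∏_{i=a}^{a+m-1} (k + i) = ∏_{l<m} (k + a + l)`. [folklore] -/
theorem prod_Icc_add_eq (a m : ℕ) (h : 1 ≤ a ∨ 1 ≤ m) (k : ℚ) :
    ∏ i ∈ Icc a (a + m - 1), (k + i) = ∏ l ∈ range m, (k + ((a : ℤ) : ℚ) + l) := by
  rcases Nat.eq_zero_or_pos m with rfl | hm
  · have ha : 1 ≤ a := h.resolve_right (by omega)
    rw [show Icc a (a + 0 - 1) = ∅ by ext x; simp only [mem_Icc, notMem_empty, iff_false]; omega]
    simp
  · rw [show Icc a (a + m - 1) = Ico a (a + m) by ext x; simp only [mem_Icc, mem_Ico]; omega,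
      prod_Ico_eq_prod_range, show a + m - a = m by omega]
    refine prod_congr rfl fun l _ => ?_
    push_cast
    ring

/-! ### The brick factorisation -/

/-- **`Rₙ(k)` as a product of bricks** ([Zudilin2004, (8.7) with the factor `h₀ + 2t` of (8.2)],
at the parameters of Theorem 3, in Fischler's variable `k`):
`Rₙ(k) = (37n+2k) · polyBrick (-27n) (27n) k ³ · polyBrick (37n+1) (27n) k ³ ·
∏_{u=1}^{10} recipBrick ((12-u)n) ((13+2u)n+1) k`. [cite: Zudilin2004, §8 (8.7)] -/
theorem R_eq_bricks (n : ℕ) (k : ℚ) :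
    R n k = (37 * n + 2 * k) * polyBrick (-(27 * n : ℕ)) (27 * n) k ^ 3 *
      polyBrick ((37 * n + 1 : ℕ)) (27 * n) k ^ 3 *
      ∏ u ∈ Icc 1 10, recipBrick (((12 - u) * n : ℕ)) ((13 + 2 * u) * n + 1) k := by
  unfold R normConst polyBrick recipBrick
  -- the three kinds of products
  have hA : ∏ i ∈ Icc 1 (27 * n), (k - i) = ∏ l ∈ range (27 * n), (k + ((-(27 * n : ℕ) : ℤ) : ℚ) + l) :=
    prod_Icc_sub_eq (27 * n) k
  have hB : ∏ i ∈ Icc (37 * n + 1) (64 * n), (k + i)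
      = ∏ l ∈ range (27 * n), (k + (((37 * n + 1 : ℕ) : ℤ) : ℚ) + l) := by
    have := prod_Icc_add_eq (37 * n + 1) (27 * n) (Or.inl (by omega)) k
    rw [show 37 * n + 1 + 27 * n - 1 = 64 * n by omega] at this
    exact this
  have hD : ∀ u ∈ Icc 1 10, ∏ i ∈ Icc ((12 - u) * n) ((25 + u) * n), (k + i)
      = ∏ l ∈ range ((13 + 2 * u) * n + 1), (k + ((((12 - u) * n : ℕ) + l : ℤ) : ℚ)) := by
    intro u hu
    have hu' := mem_Icc.1 hu
    have := prod_Icc_add_eq ((12 - u) * n) ((13 + 2 * u) * n + 1) (Or.inr (by omega)) k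
    have e : (12 - u) * n + ((13 + 2 * u) * n + 1) - 1 = (25 + u) * n := by
      have : (12 - u) * n + (13 + 2 * u) * n = (25 + u) * n := by
        rw [← add_mul]; congr 1; omega
      omega
    rw [e] at this
    rw [this]
    refine prod_congr rfl fun l _ => ?_
    push_cast; ring
  rw [hA, hB, prod_congr rfl hD]
  simp only [Rat.cast_id]
  rw [prod_mul_distrib, div_pow, div_pow]
  have h27 : ((27 * n).factorial : ℚ) ≠ 0 := by exact_mod_cast (Nat.factorial_pos _).ne'
  simp only [Nat.add_sub_cancel, prod_inv_distrib]
  rw [div_eq_mul_inv]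
  push_cast
  ring

/-! ### Antisymmetry -/

/-- The well-poised **antisymmetry** `Rₙ(-37n-k) = -Rₙ(k)` ([Zudilin2004, (8.5)], i.e.
`R̃(-t-h₀) = -R̃(t)`; [Fischler2004, §3.3]: `R_n(-37n-k) = -R_n(k)`), for every `k`.
[cite: Zudilin2004, §8 (8.5)] -/
theorem R_neg (n : ℕ) (k : ℚ) : R n (-(37 * n : ℕ) - k) = -R n k := by
  unfold R
  -- numerator products swap with a sign
  have hA : ∏ i ∈ Icc 1 (27 * n), (-((37 * n : ℕ) : ℚ) - k - i)
      = (-1) ^ (27 * n) * ∏ i ∈ Icc (37 * n + 1) (64 * n), (k + i) := by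
    have hc : (Icc (37 * n + 1) (64 * n)).card = 27 * n := by rw [Nat.card_Icc]; omega
    rw [← hc, pow_card_mul_prod]
    refine prod_nbij' (fun i => i + 37 * n) (fun i => i - 37 * n) ?_ ?_ ?_ ?_ ?_
    · intro i hi; have := mem_Icc.1 hi; exact mem_Icc.2 ⟨by omega, by omega⟩
    · intro i hi; have := mem_Icc.1 hi; exact mem_Icc.2 ⟨by omega, by omega⟩
    · intro i hi; omega
    · intro i hi; have := mem_Icc.1 hi; omega
    · intro i hi
      push_cast
      ring
  have hB : ∏ i ∈ Icc (37 * n + 1) (64 * n), (-((37 * n : ℕ) : ℚ) - k + i)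
      = (-1) ^ (27 * n) * ∏ i ∈ Icc 1 (27 * n), (k - i) := by
    have hc : (Icc 1 (27 * n)).card = 27 * n := by rw [Nat.card_Icc]; omega
    rw [show ((-1 : ℚ) ^ (27 * n)) = (-1) ^ (Icc 1 (27 * n)).card by rw [hc], pow_card_mul_prod]
    refine prod_nbij' (fun i => i - 37 * n) (fun i => i + 37 * n) ?_ ?_ ?_ ?_ ?_
    · intro i hi; have := mem_Icc.1 hi; exact mem_Icc.2 ⟨by omega, by omega⟩
    · intro i hi; have := mem_Icc.1 hi; exact mem_Icc.2 ⟨by omega, by omega⟩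
    · intro i hi; have := mem_Icc.1 hi; omega
    · intro i hi; omega
    · intro i hi
      have := mem_Icc.1 hi
      rw [Nat.cast_sub (by omega)]
      push_cast
      ring
  -- each denominator block is reflected onto itself, with an even total sign
  have hD : ∀ u ∈ Icc 1 10, ∏ i ∈ Icc ((12 - u) * n) ((25 + u) * n), (-((37 * n : ℕ) : ℚ) - k + i)
      = (-1) ^ ((13 + 2 * u) * n + 1) * ∏ i ∈ Icc ((12 - u) * n) ((25 + u) * n), (k + i) := by
    intro u hu
    have hu' := mem_Icc.1 hu
    have hsum : (12 - u) * n + (25 + u) * n = 37 * n := by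
      rw [← add_mul]; congr 1; omega
    have hcard : (Icc ((12 - u) * n) ((25 + u) * n)).card = (13 + 2 * u) * n + 1 := by
      rw [Nat.card_Icc]
      have : (25 + u) * n + 1 - (12 - u) * n = (13 + 2 * u) * n + 1 := by
        have h1 : (12 - u) * n ≤ (25 + u) * n := Nat.mul_le_mul_right _ (by omega)
        have h2 : (25 + u) * n = (12 - u) * n + (13 + 2 * u) * n := by
          rw [← add_mul]; congr 1; omega
        omega
      exact this
    rw [← hcard, ← prod_const, ← prod_mul_distrib]
    refine prod_nbij' (fun i => 37 * n - i) (fun i => 37 * n - i) ?_ ?_ ?_ ?_ ?_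
    · intro i hi; have := mem_Icc.1 hi; exact mem_Icc.2 ⟨by omega, by omega⟩
    · intro i hi; have := mem_Icc.1 hi; exact mem_Icc.2 ⟨by omega, by omega⟩
    · intro i hi; have := mem_Icc.1 hi; omega
    · intro i hi; have := mem_Icc.1 hi; omega
    · intro i hi
      have := mem_Icc.1 hi
      rw [Nat.cast_sub (by omega)]
      push_cast
      ring
  have hDall : ∏ u ∈ Icc 1 10, ∏ i ∈ Icc ((12 - u) * n) ((25 + u) * n), (-((37 * n : ℕ) : ℚ) - k + i)
      = ∏ u ∈ Icc 1 10, ∏ i ∈ Icc ((12 - u) * n) ((25 + u) * n), (k + i) := by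
    rw [prod_congr rfl hD, prod_mul_distrib]
    have hsign : ∏ u ∈ Icc 1 10, ((-1 : ℚ) ^ ((13 + 2 * u) * n + 1)) = 1 := by
      rw [prod_pow_eq_pow_sum]
      have : ∑ u ∈ Icc 1 10, ((13 + 2 * u) * n + 1) = 2 * (120 * n + 5) := by
        simp [show Icc 1 10 = {1,2,3,4,5,6,7,8,9,10} by rfl]
        ring
      rw [this, pow_mul, neg_one_sq, one_pow]
    rw [hsign, one_mul]
  rw [hA, hB, hDall]
  simp only [Rat.cast_id]
  have hsign3 : ((-1 : ℚ) ^ (27 * n)) ^ 3 * ((-1 : ℚ) ^ (27 * n)) ^ 3 = 1 := by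
    rw [← mul_pow, ← pow_add, ← two_mul, pow_mul, neg_one_sq, one_pow, one_pow]
  rw [mul_pow, mul_pow, ← neg_div]
  congr 1
  push_cast
  linear_combination (-(normConst n : ℚ) * (37 * n + 2 * k) *
    (∏ i ∈ Icc 1 (27 * n), (k - i)) ^ 3 * (∏ i ∈ Icc (37 * n + 1) (64 * n), (k + i)) ^ 3) * hsign3

/-! ### Regularisation at a pole -/

/-- `G n i k`: the product `Rₙ(k) (k+i)^{10}`, written as a product of bricks in which each of the
ten reciprocal bricks has absorbed one factor `k + i` (`recipBrickReg`), so that it is regular at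
`k = -i` for every `i`. Its divided derivatives at `-i` are the partial-fraction coefficients of
`Rₙ` at the pole `-i` ([Zudilin2004, proof of Lemma 19]: `B_{jk} = (1/(q-j)!)(R(t)(t+k)^{q-r})^{(q-j)}|_{t=-k}`).
[cite: Zudilin2004, §8 Lemma 19 (proof)] -/
def G (n i : ℕ) (k : ℚ) : ℚ :=
  (37 * n + 2 * k) * polyBrick (-(27 * n : ℕ)) (27 * n) k ^ 3 *
    polyBrick ((37 * n + 1 : ℕ)) (27 * n) k ^ 3 *
    ∏ u ∈ Icc 1 10, recipBrickReg (((12 - u) * n : ℕ)) ((13 + 2 * u) * n + 1) i k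

/-- Away from `k = -i`: `G n i k = Rₙ(k) (k + i)^{10}`. [cite: Zudilin2004, §8 Lemma 19 (proof)] -/
theorem G_eq (n i : ℕ) {k : ℚ} (hk : k + i ≠ 0) : G n i k = R n k * (k + i) ^ 10 := by
  rw [G, R_eq_bricks]
  have h : ∀ u ∈ Icc 1 10, recipBrickReg (((12 - u) * n : ℕ)) ((13 + 2 * u) * n + 1) i k
      = recipBrick (((12 - u) * n : ℕ)) ((13 + 2 * u) * n + 1) k * (k + i) := fun u _ =>
    recipBrickReg_eq _ _ _ (by exact_mod_cast hk)
  rw [prod_congr rfl h, prod_mul_distrib, prod_const, Nat.card_Icc]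
  push_cast
  ring

end Zudilin2004

end Literature.NumberTheory.Transcendental
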